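import Mathlib.Analysis.Convex.Jensen
import Mathlib.Analysis.Convex.SpecificFunctions.Basic
import Mathlib.Analysis.SpecialFunctions.Log.Base
import HarnessLib

/-!
# Shannon entropy of the image of a uniform distribution (`mapEntropy`)

Topic `Literature/InformationTheory/Entropy`. For a finite set `S` and a map `f`, the random
variable `f(U_S)` — `f` applied to a uniform sample of `S` — takes the value `y` with probability
`p_y = |f⁻¹(y) ∩ S| / |S|`. Its **Shannon entropy in bits** is
`H(f(U_S)) = ∑_y p_y log₂ (1/p_y) = E_{v ← S}[log₂ (|S| / |f⁻¹(f v) ∩ S|)]`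
(Cover–Thomas (2.1)–(2.3): `H(X) = E log 1/p(X)`; Liu–Pass §2.6). This file is the
cryptography-free, Mathlib-only home of this notion and of its elementary ("folklore") rules; it
is imported by `Literature/Computability/Complexity/PolynomialEntropyApproximation.lean` (the
promise problems `PEA`/`PED` of Dvir–Gutfreund–Rothblum–Vadhan, whose instances are compared by
exactly this entropy, [DGRV, Def 2.1]) and by the Liu–Pass files under
`Literature/Computability/Cryptography/` (cond EP-PRGs, `LiuPassCondEPPRG.lean`), which until
2026-08 carried these declarations themselves.

## Contents

* `fiber S f y = {w ∈ S | f w = y}` with `mem_fiber`, `fiber_subset`, `self_mem_fiber`,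
  `card_fiber_pos`, `card_fiber_le`;
* `mapEntropy S f = (1/|S|) ∑_{v ∈ S} log₂ (|S| / |fiber S f (f v)|)` (junk value `0` for `S = ∅`),
  `mapEntropy_eq_sum_image` (the grouped form `∑_y p_y log₂ (1/p_y)`), the pointwise surprise
  bounds `logb_card_div_card_fiber_nonneg/le/le_of_card_le`, and the range
  `0 ≤ H ≤ log₂ |S|` (`mapEntropy_nonneg`, `mapEntropy_le_logb_card`, `mapEntropy_empty`);
* invariance and calculus: `mapEntropy_congr`, `mapEntropy_comp_of_injOn` (injective
  post-processing), `mapEntropy_univ_comp_equiv` and `mapEntropy_image` (re-indexing the sample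
  space), `mapEntropy_product` (additivity on independent pairs), `mapEntropy_of_injective`
  (`= log₂ |S|`), `mapEntropy_const` (`= 0`), `mapEntropy_comp_le` (deterministic data processing,
  `H(g(f(U))) ≤ H(f(U))`), `mapEntropy_sub_le_mapEntropy_comp` (a map with fibres `≤ 2^c` on the
  image loses at most `c` bits; Jensen);
* counting consequences used by Liu–Pass (FOCS 2020, proof of Thm 5.2, Claim 2):
  the reverse Markov inequality `card_le_mul_card_filter_of_le_sum` and the "flatness" bound
  `card_filter_div_card_le_of_mapEntropy`
  (`Pr[Q(f U_S)] ≤ a/(a+1) + 2^{a+1-n} · #{y ∈ f(S) | Q y}` when `H ≥ n - a` and every surprise is `≤ n`).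

## Design choices

* The bodies of `fiber` and `mapEntropy` are fixed VERBATIM (route PneNP/SzkEntropy spells
  `PEA_d` inline over Mathlib and relies on `Iff.rfl` against
  `Literature.Computability.Complexity.PEA d`, whose entropy is `mapEntropy Finset.univ P.eval`):
  do not refactor them. `Literature.Computability.Cryptography.mapEntropy/fiber`
  (`LiuPassCondEPPRG.lean`) have the same bodies and are definitionally equal to these.
* Base-2 logarithms (`Real.logb 2`), values in `ℝ`; no `PMF`/measure theory (the tree's
  `Literature.Computability.AlgebraicComplexity.shannonEntropy` is the natural-log entropy of a
  probability vector on a `Fintype`; `mapEntropy S f` is `1/log 2` times that of the image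
  distribution on `S.image f` — not imported here to keep the import closure minimal).
* Not here: conditional entropy, mutual information, min-entropy, Rényi entropies, the chain rule.

## References

* T. M. Cover, J. A. Thomas, *Elements of Information Theory*, 2nd ed., Wiley 2006: (2.1)–(2.3)
  (entropy, `H(X) = E log 1/p(X)`), Thm 2.6.4 (`H ≤ log |𝒳|`), Problem 2.4 (entropy of a function
  of a random variable, `H(g(X)) ≤ H(X)`).
* Y. Liu, R. Pass, *On one-way functions and Kolmogorov complexity*, FOCS 2020 /
  arXiv:2009.11514: §2.6 (`H(X) = E[log 1/Pr[X = x]]`), §5.2 (proof of Thm 5.2, Claims 1–2).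
* Z. Dvir, D. Gutfreund, G. N. Rothblum, S. Vadhan, *On approximating the entropy of polynomial
  mappings*, ECCC TR10-160 / ICS 2011: Def 2.1, Claim 2.2, §3 p. 6.
-/

namespace Literature.InformationTheory.Entropy

open Finset

variable {ι ι' κ β β' : Type*} [DecidableEq β] [DecidableEq β']

/-! ### Fibres inside a finite set -/

/-- The fibre of `f` over `y` inside the finite set `S`: `{w ∈ S | f w = y}`. (Body fixed; see the
module docstring.) [folklore] -/
def fiber (S : Finset ι) (f : ι → β) (y : β) : Finset ι :=
  S.filter fun w => f w = y

/-- Membership in a fibre, unfolded. [folklore] -/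
@[simp] theorem mem_fiber {S : Finset ι} {f : ι → β} {y : β} {w : ι} :
    w ∈ fiber S f y ↔ w ∈ S ∧ f w = y := by
  simp [fiber]

/-- A fibre is a subset of the ambient finite set. [folklore] -/
theorem fiber_subset (S : Finset ι) (f : ι → β) (y : β) : fiber S f y ⊆ S :=
  Finset.filter_subset _ _

/-- Every point of `S` lies in its own fibre. [folklore] -/
theorem self_mem_fiber {S : Finset ι} (f : ι → β) {v : ι} (hv : v ∈ S) : v ∈ fiber S f (f v) :=
  mem_fiber.2 ⟨hv, rfl⟩

/-- The fibre through a point of `S` is nonempty, so has positive cardinality. [folklore] -/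
theorem card_fiber_pos {S : Finset ι} (f : ι → β) {v : ι} (hv : v ∈ S) :
    0 < (fiber S f (f v)).card :=
  Finset.card_pos.2 ⟨v, self_mem_fiber f hv⟩

/-- A fibre is at most as large as `S`. [folklore] -/
theorem card_fiber_le (S : Finset ι) (f : ι → β) (y : β) : (fiber S f y).card ≤ S.card :=
  Finset.card_le_card (fiber_subset S f y)

/-! ### The entropy of `f(U_S)` -/

/-- **Shannon entropy of `f(U_S)`**, the image under `f` of the uniform distribution on the finite
set `S`, in bits, written in the "expected surprise" form
`H(f(U_S)) = E_{v ← S}[log₂ (1 / Pr[f(U_S) = f(v)])] = (1/|S|) ∑_{v ∈ S} log₂ (|S| / |f⁻¹(f v) ∩ S|)`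
(Cover–Thomas (2.3): `H(X) = E log 1/p(X)`; Liu–Pass §2.6: "`H(X) = E[log 1/Pr[X = x]]`"). Equal
to the familiar `∑_y p_y log₂ (1/p_y)` over the image (`mapEntropy_eq_sum_image`). Junk value `0`
for `S = ∅` (`mapEntropy_empty`). (Body fixed; see the module docstring.)
[T. Cover, J. Thomas, *Elements of Information Theory*, 2nd ed., (2.1)–(2.3); Y. Liu, R. Pass,
FOCS 2020, §2.6] [cite: LiuPassFOCS2020, §2.6] -/
noncomputable def mapEntropy (S : Finset ι) (f : ι → β) : ℝ :=
  (∑ v ∈ S, Real.logb 2 ((S.card : ℝ) / (fiber S f (f v)).card)) / S.card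

/-- `mapEntropy` is the Shannon entropy `∑_{y ∈ f(S)} p_y log₂ (1/p_y)` of the image distribution
`p_y = |f⁻¹(y) ∩ S| / |S|` (grouping the expectation by fibres). [Cover–Thomas, 2nd ed., (2.1)–(2.3)]
[folklore] -/
theorem mapEntropy_eq_sum_image (S : Finset ι) (f : ι → β) :
    mapEntropy S f = ∑ y ∈ S.image f,
      ((fiber S f y).card : ℝ) / S.card * Real.logb 2 ((S.card : ℝ) / (fiber S f y).card) := by
  unfold mapEntropy
  rw [Finset.sum_comp (fun y => Real.logb 2 ((S.card : ℝ) / (fiber S f y).card)) f, Finset.sum_div]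
  refine Finset.sum_congr rfl fun y _ => ?_
  rw [nsmul_eq_mul]
  simp only [fiber]
  ring

/-- On the empty set the entropy takes the junk value `0`. [folklore] -/
@[simp] theorem mapEntropy_empty (f : ι → β) : mapEntropy (∅ : Finset ι) f = 0 := by
  simp [mapEntropy]

/-- The surprise of every outcome is at most `log₂ |S|` (min-entropy at most `log₂ |S|`): for
`v ∈ S`, `log₂ (|S| / |f⁻¹(f v) ∩ S|) ≤ log₂ |S|`. [Y. Liu, R. Pass, FOCS 2020, proof of Thm 5.2
("`-log Pr[G(U_n | E_n) = y]` is upper bounded by `n`")] [folklore] -/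
theorem logb_card_div_card_fiber_le {S : Finset ι} (f : ι → β) {v : ι} (hv : v ∈ S) :
    Real.logb 2 ((S.card : ℝ) / (fiber S f (f v)).card) ≤ Real.logb 2 S.card := by
  have hS : (0 : ℝ) < S.card := by exact_mod_cast Finset.card_pos.2 ⟨v, hv⟩
  have hF : (1 : ℝ) ≤ (fiber S f (f v)).card := by exact_mod_cast card_fiber_pos f hv
  refine Real.logb_le_logb_of_le (by norm_num) (by positivity) ?_
  exact div_le_self hS.le hF

/-- The surprise of every outcome is nonnegative: `0 ≤ log₂ (|S| / |f⁻¹(f v) ∩ S|)`. [folklore] -/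
theorem logb_card_div_card_fiber_nonneg {S : Finset ι} (f : ι → β) {v : ι} (hv : v ∈ S) :
    0 ≤ Real.logb 2 ((S.card : ℝ) / (fiber S f (f v)).card) := by
  have hF : (0 : ℝ) < (fiber S f (f v)).card := by exact_mod_cast card_fiber_pos f hv
  refine Real.logb_nonneg (by norm_num) ?_
  rw [le_div_iff₀ hF, one_mul]
  exact_mod_cast card_fiber_le S f (f v)

/-- Under `|S| ≤ 2^n` every surprise is at most `n` (Liu–Pass: "`-log Pr[G(U_n|E_n) = y]` is upper
bounded by `n` since `H_∞(G(U_n|E_n)) ≤ H_∞(U_n|E_n) ≤ H_∞(U_n) = n`").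
[Y. Liu, R. Pass, FOCS 2020, proof of Thm 5.2, Claim 2] [cite: LiuPassFOCS2020, Thm 5.2 (proof, Claim 2)] -/
theorem logb_card_div_card_fiber_le_of_card_le {S : Finset ι} (f : ι → β) {v : ι} (hv : v ∈ S)
    {n : ℕ} (hn : S.card ≤ 2 ^ n) :
    Real.logb 2 ((S.card : ℝ) / (fiber S f (f v)).card) ≤ n := by
  refine (logb_card_div_card_fiber_le f hv).trans ?_
  rw [Real.logb_le_iff_le_rpow (by norm_num) (by exact_mod_cast Finset.card_pos.2 ⟨v, hv⟩),
    Real.rpow_natCast]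
  exact_mod_cast hn

/-- **Entropy is nonnegative**: `0 ≤ H(f(U_S))` (every surprise is `≥ 0`).
[Cover–Thomas, 2nd ed., Lemma 2.1.1] [folklore] -/
theorem mapEntropy_nonneg (S : Finset ι) (f : ι → β) : 0 ≤ mapEntropy S f :=
  div_nonneg (Finset.sum_nonneg fun _ hv => logb_card_div_card_fiber_nonneg f hv) (Nat.cast_nonneg _)

/-- **Entropy is at most `log₂` of the sample-space size**: `H(f(U_S)) ≤ log₂ |S|` (every surprise
is `≤ log₂ |S|`; for `S = ∅` both sides are `0`). [Cover–Thomas, 2nd ed., Thm 2.6.4 with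
Problem 2.4 (`H(f(U_S)) ≤ H(U_S) = log |S|`)] [folklore] -/
theorem mapEntropy_le_logb_card (S : Finset ι) (f : ι → β) : mapEntropy S f ≤ Real.logb 2 S.card := by
  rcases S.eq_empty_or_nonempty with rfl | hS
  · simp
  have hSpos : (0 : ℝ) < S.card := by exact_mod_cast hS.card_pos
  unfold mapEntropy
  rw [div_le_iff₀ hSpos]
  calc ∑ v ∈ S, Real.logb 2 ((S.card : ℝ) / (fiber S f (f v)).card)
      ≤ ∑ _v ∈ S, Real.logb 2 (S.card : ℝ) := Finset.sum_le_sum fun v hv => logb_card_div_card_fiber_le f hv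
    _ = Real.logb 2 S.card * S.card := by rw [Finset.sum_const, nsmul_eq_mul, mul_comm]

/-! ### Invariance, additivity, data processing -/

/-- `mapEntropy` only depends on the values of the map on the set. [folklore] -/
theorem mapEntropy_congr {S : Finset ι} {f g : ι → β} (h : ∀ v ∈ S, f v = g v) :
    mapEntropy S f = mapEntropy S g := by
  unfold mapEntropy
  congr 1
  refine Finset.sum_congr rfl fun v hv => ?_
  have hfib : fiber S f (f v) = fiber S g (g v) := by
    ext w
    simp only [mem_fiber]
    constructor
    · rintro ⟨hw, hfw⟩; exact ⟨hw, by rw [← h w hw, hfw, h v hv]⟩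
    · rintro ⟨hw, hgw⟩; exact ⟨hw, by rw [h w hw, hgw, h v hv]⟩
  rw [hfib]

/-- **Entropy is invariant under post-composition with a map injective on the outputs**:
if `g (f a) = g (f b) → f a = f b` for `a, b ∈ S` then `H(g(f(U_S))) = H(f(U_S))` (the fibres of
`g ∘ f` and of `f` through every point of `S` coincide).  Covers output translations
`y ↦ y + c` and invertible affine output maps of polynomial maps.
[Cover–Thomas, *Elements of Information Theory*, 2nd ed., Problem 2.4; DGRV 2010, §3] [folklore] -/
theorem mapEntropy_comp_of_injOn {S : Finset ι} (f : ι → β) (g : β → β')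
    (hg : ∀ a ∈ S, ∀ b ∈ S, g (f a) = g (f b) → f a = f b) :
    mapEntropy S (g ∘ f) = mapEntropy S f := by
  unfold mapEntropy
  congr 1
  refine Finset.sum_congr rfl fun v hv => ?_
  have hfib : fiber S (g ∘ f) ((g ∘ f) v) = fiber S f (f v) := by
    ext w
    simp only [mem_fiber, Function.comp_apply]
    exact ⟨fun h => ⟨h.1, hg w h.1 v hv h.2⟩, fun h => ⟨h.1, by rw [h.2]⟩⟩
  rw [hfib]

/-- **Entropy is invariant under re-indexing the sample space**: for an equivalence
`e : ι' ≃ ι`, `H((f ∘ e)(U_{ι'})) = H(f(U_ι))` (`f ∘ e` on a uniform `ι'`-sample has the law of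
`f` on a uniform `ι`-sample). [folklore] -/
theorem mapEntropy_univ_comp_equiv [Fintype ι] [Fintype ι'] (e : ι' ≃ ι) (f : ι → β) :
    mapEntropy Finset.univ (f ∘ e) = mapEntropy Finset.univ f := by
  unfold mapEntropy
  have hcard : ((Finset.univ : Finset ι').card : ℝ) = (Finset.univ : Finset ι).card := by
    rw [Finset.card_univ, Finset.card_univ, Fintype.card_congr e]
  have hfib : ∀ y, (fiber Finset.univ (f ∘ e) y).card = (fiber Finset.univ f y).card := fun y => by
    refine Finset.card_bij (fun w _ => e w) (fun w hw => ?_) (fun a _ b _ h => e.injective h)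
      (fun v hv => ⟨e.symm v, ?_, e.apply_symm_apply v⟩)
    · simpa [mem_fiber] using hw
    · simpa [mem_fiber] using hv
  rw [hcard]
  congr 1
  simp_rw [hfib]
  exact Equiv.sum_comp e
    (fun v => Real.logb 2 (((Finset.univ : Finset ι).card : ℝ) / (fiber Finset.univ f (f v)).card))

/-- **Re-indexing along an injection**: `H(f(U_{h(W)})) = H((f ∘ h)(U_W))` for `h` injective.
[folklore] -/
theorem mapEntropy_image [DecidableEq ι] {W : Finset κ} {h : κ → ι} (hh : Function.Injective h)
    (f : ι → β) : mapEntropy (W.image h) f = mapEntropy W (f ∘ h) := by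
  unfold mapEntropy
  rw [Finset.card_image_of_injective _ hh, Finset.sum_image fun x _ y _ hxy => hh hxy]
  congr 1
  refine Finset.sum_congr rfl fun w hw => ?_
  have hfib : fiber (W.image h) f (f (h w)) = (fiber W (f ∘ h) ((f ∘ h) w)).image h := by
    ext v
    simp only [mem_fiber, Finset.mem_image, Function.comp_apply]
    constructor
    · rintro ⟨⟨x, hx, rfl⟩, hfx⟩; exact ⟨x, ⟨hx, hfx⟩, rfl⟩
    · rintro ⟨x, ⟨hx, hfx⟩, rfl⟩; exact ⟨⟨x, hx, rfl⟩, hfx⟩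
  rw [hfib, Finset.card_image_of_injective _ hh]

/-- **Entropy is additive on independent pairs**: for nonempty `S, T`,
`H((f × g)(U_{S × T})) = H(f(U_S)) + H(g(U_T))` — the fibre of `f × g` through `(a, b)` is the
product of the fibres, and `log₂` turns the product of probabilities into a sum.  In particular
`H(Pᵗ) = t · H(P)` for direct powers. [Cover–Thomas, 2nd ed., Thm 2.6.6 (independence bound, case
of equality); DGRV 2010, §3, p. 6 ("`H(Pᵗ) = t · H(P)`")] [cite: DvirGutfreundRothblumVadhan2010, §3 p.6] -/
theorem mapEntropy_product {S : Finset ι} {T : Finset ι'} (hS : S.Nonempty) (hT : T.Nonempty)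
    (f : ι → β) (g : ι' → β') :
    mapEntropy (S ×ˢ T) (Prod.map f g) = mapEntropy S f + mapEntropy T g := by
  have hS0 : (S.card : ℝ) ≠ 0 := by exact_mod_cast hS.card_pos.ne'
  have hT0 : (T.card : ℝ) ≠ 0 := by exact_mod_cast hT.card_pos.ne'
  have hfib : ∀ a ∈ S, ∀ b ∈ T,
      fiber (S ×ˢ T) (Prod.map f g) (Prod.map f g (a, b)) = fiber S f (f a) ×ˢ fiber T g (g b) := by
    intro a _ b _
    ext ⟨v, w⟩
    simp only [mem_fiber, Finset.mem_product, Prod.map_apply, Prod.mk.injEq]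
    tauto
  have hterm : ∀ a ∈ S, ∀ b ∈ T,
      Real.logb 2 (((S ×ˢ T).card : ℝ) / (fiber (S ×ˢ T) (Prod.map f g) (Prod.map f g (a, b))).card) =
        Real.logb 2 ((S.card : ℝ) / (fiber S f (f a)).card) +
          Real.logb 2 ((T.card : ℝ) / (fiber T g (g b)).card) := by
    intro a ha b hb
    have hFa : ((fiber S f (f a)).card : ℝ) ≠ 0 := by exact_mod_cast (card_fiber_pos f ha).ne'
    have hGb : ((fiber T g (g b)).card : ℝ) ≠ 0 := by exact_mod_cast (card_fiber_pos g hb).ne'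
    rw [hfib a ha b hb, Finset.card_product, Finset.card_product, Nat.cast_mul, Nat.cast_mul,
      mul_div_mul_comm, Real.logb_mul (div_ne_zero hS0 hFa) (div_ne_zero hT0 hGb)]
  unfold mapEntropy
  rw [Finset.sum_product, Finset.sum_congr rfl fun a ha => Finset.sum_congr rfl fun b hb => hterm a ha b hb]
  rw [Finset.card_product, Nat.cast_mul]
  simp only [Finset.sum_add_distrib, Finset.sum_const, nsmul_eq_mul]
  rw [← Finset.mul_sum]
  field_simp

/-- The image of a uniform distribution under an injective map is uniform on `|S|` points:
`H(f(U_S)) = log₂ |S|` (every fibre is a singleton; a "flat" distribution).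
[Cover–Thomas, 2nd ed., Thm 2.6.4 (equality case); DGRV 2010, Claim 2.2 (flat distributions)]
[cite: DvirGutfreundRothblumVadhan2010, Claim 2.2] -/
theorem mapEntropy_of_injective (S : Finset ι) {f : ι → β} (hf : Function.Injective f) :
    mapEntropy S f = Real.logb 2 S.card := by
  rcases S.eq_empty_or_nonempty with rfl | hS
  · simp [mapEntropy]
  have hfib : ∀ v ∈ S, fiber S f (f v) = {v} := fun v hv => by
    ext w
    simp only [mem_fiber, Finset.mem_singleton]
    exact ⟨fun h => hf h.2, fun h => ⟨h ▸ hv, by rw [h]⟩⟩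
  unfold mapEntropy
  rw [Finset.sum_congr rfl fun v hv => by rw [hfib v hv, Finset.card_singleton, Nat.cast_one, div_one],
    Finset.sum_const, nsmul_eq_mul]
  exact mul_div_cancel_left₀ _ (by exact_mod_cast hS.card_pos.ne')

/-- A constant map has output entropy `0` (one fibre, of full size). [Cover–Thomas, 2nd ed.,
Lemma 2.1.1 neighbourhood (`H = 0` iff deterministic); DGRV 2010, Claim 2.2]
[cite: DvirGutfreundRothblumVadhan2010, Claim 2.2] -/
theorem mapEntropy_const (S : Finset ι) (c : β) : mapEntropy S (fun _ : ι => c) = 0 := by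
  rcases S.eq_empty_or_nonempty with rfl | hS
  · simp [mapEntropy]
  have hfib : fiber S (fun _ : ι => c) c = S := by
    ext w
    simp [mem_fiber]
  have h0 : (S.card : ℝ) ≠ 0 := by exact_mod_cast hS.card_pos.ne'
  unfold mapEntropy
  simp only [hfib, div_self h0, Real.logb_one, Finset.sum_const_zero, zero_div]

/-- **Deterministic post-processing does not increase entropy**: `H(g(f(U_S))) ≤ H(f(U_S))`
(the fibre of `g ∘ f` through a point contains the fibre of `f`, so every surprise can only
drop). [Cover–Thomas, 2nd ed., Problem 2.4 (`H(g(X)) ≤ H(X)`)] [folklore] -/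
theorem mapEntropy_comp_le (S : Finset ι) (f : ι → β) (g : β → β') :
    mapEntropy S (g ∘ f) ≤ mapEntropy S f := by
  unfold mapEntropy
  rcases S.eq_empty_or_nonempty with rfl | hS
  · simp
  have hSpos : (0 : ℝ) < S.card := by exact_mod_cast hS.card_pos
  rw [div_le_div_iff_of_pos_right hSpos]
  refine Finset.sum_le_sum fun v hv => ?_
  have hsub : fiber S f (f v) ⊆ fiber S (g ∘ f) ((g ∘ f) v) := by
    intro w hw
    rw [mem_fiber] at hw ⊢
    exact ⟨hw.1, by simp [hw.2]⟩
  have h1 : (0 : ℝ) < (fiber S f (f v)).card := by exact_mod_cast card_fiber_pos f hv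
  have h2 : ((fiber S f (f v)).card : ℝ) ≤ (fiber S (g ∘ f) ((g ∘ f) v)).card := by
    exact_mod_cast Finset.card_le_card hsub
  exact Real.logb_le_logb_of_le (by norm_num) (div_pos hSpos (by linarith))
    (div_le_div_of_nonneg_left hSpos.le h1 h2)

/-- **A map with fibres of size `≤ 2^c` on the image loses at most `c` bits of entropy**: if every
fibre of `g` restricted to `f(S)` has at most `2^c` elements then `H(g(f(U_S))) ≥ H(f(U_S)) - c`.
Proof: `H(f U_S) - H(g f U_S) = E_v[log₂ (|fibre of g∘f through v| / |fibre of f through v|)]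
≤ log₂ E_v[…]` (Jensen) and the expectation equals `(1/|S|) ∑_{y ∈ f(S)} |(g∘f)⁻¹(g y) ∩ S| ≤ 2^c`.
This is `H(g(X)) ≥ H(X) - H(X | g(X)) ≥ H(X) - max_z log₂ |g⁻¹(z) ∩ supp X|`; used by Liu–Pass for
the truncated generators `G^c` ("`G^c` is also a cond EP-PRG").
[Cover–Thomas, 2nd ed., (2.14) and Problem 2.4; Y. Liu, R. Pass, FOCS 2020, proof of Thm 5.2
(first paragraph, the truncations `G^c`)] [cite: LiuPassFOCS2020, Thm 5.2 (proof)] -/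
theorem mapEntropy_sub_le_mapEntropy_comp {S : Finset ι} (hS : S.Nonempty) (f : ι → β) (g : β → β')
    (c : ℕ) (hg : ∀ z, ((S.image f).filter fun y => g y = z).card ≤ 2 ^ c) :
    mapEntropy S f - c ≤ mapEntropy S (g ∘ f) := by
  have hSpos : (0 : ℝ) < S.card := by exact_mod_cast hS.card_pos
  -- abbreviations for the two fibre sizes through a point
  set F : ι → ℝ := fun v => ((fiber S f (f v)).card : ℝ) with hFdef
  set Gf : ι → ℝ := fun v => ((fiber S (g ∘ f) (g (f v))).card : ℝ) with hGdef
  have hFpos : ∀ v ∈ S, 0 < F v := fun v hv => by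
    simp only [hFdef]
    exact_mod_cast card_fiber_pos f hv
  have hGpos : ∀ v ∈ S, 0 < Gf v := fun v hv => by
    simp only [hGdef]
    exact_mod_cast card_fiber_pos (g ∘ f) hv
  -- Step 1: the entropy difference is the average of `log₂ (Gf / F)`
  have hdiff : mapEntropy S f - mapEntropy S (g ∘ f) =
      (∑ v ∈ S, Real.logb 2 (Gf v / F v)) / S.card := by
    unfold mapEntropy
    rw [← sub_div, ← Finset.sum_sub_distrib]
    congr 1
    refine Finset.sum_congr rfl fun v hv => ?_
    have hF := hFpos v hv
    have hG := hGpos v hv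
    simp only [Function.comp_apply]
    rw [Real.logb_div hSpos.ne' hF.ne', Real.logb_div hSpos.ne' hG.ne', Real.logb_div hG.ne' hF.ne']
    ring
  -- Step 2: Jensen for the concave `log`
  have hJ : (∑ v ∈ S, Real.logb 2 (Gf v / F v)) / S.card ≤
      Real.logb 2 ((∑ v ∈ S, Gf v / F v) / S.card) := by
    have hlog := (strictConcaveOn_log_Ioi.concaveOn).le_map_sum (t := S) (w := fun _ => (S.card : ℝ)⁻¹)
      (p := fun v => Gf v / F v) (fun _ _ => by positivity)
      (by rw [Finset.sum_const, nsmul_eq_mul, mul_inv_cancel₀ hSpos.ne'])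
      (fun v hv => Set.mem_Ioi.2 (div_pos (hGpos v hv) (hFpos v hv)))
    simp only [smul_eq_mul, ← Finset.mul_sum] at hlog
    have hlog2 : (0 : ℝ) < Real.log 2 := Real.log_pos (by norm_num)
    unfold Real.logb
    rw [← Finset.sum_div, div_div, mul_comm (Real.log 2), ← div_div, div_le_div_iff_of_pos_right hlog2]
    calc (∑ v ∈ S, Real.log (Gf v / F v)) / S.card = (S.card : ℝ)⁻¹ * ∑ v ∈ S, Real.log (Gf v / F v) := by
          rw [div_eq_inv_mul]
      _ ≤ Real.log ((S.card : ℝ)⁻¹ * ∑ v ∈ S, Gf v / F v) := hlog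
      _ = Real.log ((∑ v ∈ S, Gf v / F v) / S.card) := by rw [div_eq_inv_mul]
  -- Step 3: the average of `Gf / F` is at most `2 ^ c`
  have hsum1 : ∑ v ∈ S, Gf v / F v = ∑ y ∈ S.image f, ((fiber S (g ∘ f) (g y)).card : ℝ) := by
    rw [Finset.sum_comp (fun y => ((fiber S (g ∘ f) (g y)).card : ℝ) / (fiber S f y).card) f]
    refine Finset.sum_congr rfl fun y hy => ?_
    obtain ⟨v, hv, rfl⟩ := Finset.mem_image.1 hy
    rw [nsmul_eq_mul]
    have hF := hFpos v hv
    simp only [hFdef, fiber] at hF ⊢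
    field_simp
  have hsum2 : ∑ y ∈ S.image f, ((fiber S (g ∘ f) (g y)).card : ℝ) ≤ 2 ^ c * S.card := by
    rw [Finset.sum_comp (fun z => ((fiber S (g ∘ f) z).card : ℝ)) g]
    calc ∑ z ∈ (S.image f).image g, ((S.image f).filter fun y => g y = z).card • ((fiber S (g ∘ f) z).card : ℝ)
        ≤ ∑ z ∈ (S.image f).image g, (2 ^ c : ℝ) * ((fiber S (g ∘ f) z).card : ℝ) := by
          refine Finset.sum_le_sum fun z _ => ?_
          rw [nsmul_eq_mul]
          gcongr
          exact_mod_cast hg z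
      _ = 2 ^ c * ∑ z ∈ S.image (g ∘ f), ((fiber S (g ∘ f) z).card : ℝ) := by
          rw [← Finset.mul_sum, Finset.image_image]
      _ = 2 ^ c * S.card := by
          congr 1
          have h := Finset.card_eq_sum_card_image (g ∘ f) S
          simp only [fiber]
          exact_mod_cast h.symm
  have havg : (∑ v ∈ S, Gf v / F v) / S.card ≤ 2 ^ c := by
    rw [div_le_iff₀ hSpos, hsum1]
    exact hsum2
  have hpos : 0 < (∑ v ∈ S, Gf v / F v) / S.card := by
    obtain ⟨v, hv⟩ := hS
    refine div_pos (Finset.sum_pos' (fun w hw => (div_pos (hGpos w hw) (hFpos w hw)).le)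
      ⟨v, hv, div_pos (hGpos v hv) (hFpos v hv)⟩) hSpos
  have hfin : Real.logb 2 ((∑ v ∈ S, Gf v / F v) / S.card) ≤ c := by
    calc Real.logb 2 ((∑ v ∈ S, Gf v / F v) / S.card) ≤ Real.logb 2 ((2 : ℝ) ^ c) :=
          Real.logb_le_logb_of_le (by norm_num) hpos havg
      _ = c := by
          rw [Real.logb_pow, Real.logb_self_eq_one (by norm_num)]
          ring
  linarith [hdiff, hJ, hfin]

/-! ### Counting consequences (reverse Markov; flatness of high-entropy images) -/

/-- **Reverse Markov inequality**. If `X ≤ N` on the finite set `S` and the average of `X` over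
`S` is at least `N - a`, then at least a `1/(a+1)` fraction of the points of `S` have
`X ≥ N - a - 1`: `|S| ≤ (a + 1) · |{v ∈ S | X v ≥ N - a - 1}|` (no sign condition on `a` is
needed; for `S = ∅` both sides vanish). This is the averaging step of Liu–Pass's Claim 2 (print
states the fraction as `1/n`, using `a + 1 = α log n + 1 ≤ n`). [Y. Liu, R. Pass, FOCS 2020,
proof of Thm 5.2, Claim 2 ("By an averaging argument, with probability at least `1/n` …")]
[cite: LiuPassFOCS2020, Thm 5.2 (proof, Claim 2)] -/
theorem card_le_mul_card_filter_of_le_sum {S : Finset ι} {X : ι → ℝ} {N a : ℝ}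
    (hX : ∀ v ∈ S, X v ≤ N) (hsum : (N - a) * S.card ≤ ∑ v ∈ S, X v) :
    (S.card : ℝ) ≤ (a + 1) * (S.filter fun v => N - a - 1 ≤ X v).card := by
  set G := S.filter fun v => N - a - 1 ≤ X v with hG
  set B := S.filter fun v => ¬ N - a - 1 ≤ X v with hB
  have hsplit : ∑ v ∈ S, X v = ∑ v ∈ G, X v + ∑ v ∈ B, X v :=
    (Finset.sum_filter_add_sum_filter_not S (fun v => N - a - 1 ≤ X v) X).symm
  have hcard : (G.card : ℝ) + B.card = S.card := by
    exact_mod_cast Finset.card_filter_add_card_filter_not (fun v => N - a - 1 ≤ X v)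
  have hGsum : ∑ v ∈ G, X v ≤ G.card * N := by
    have h := Finset.sum_le_card_nsmul G X N fun v hv => hX v (Finset.mem_filter.1 hv).1
    rwa [nsmul_eq_mul] at h
  have hBsum : ∑ v ∈ B, X v ≤ B.card * (N - a - 1) := by
    have h := Finset.sum_le_card_nsmul B X (N - a - 1) fun v hv =>
      (not_le.1 (Finset.mem_filter.1 hv).2).le
    rwa [nsmul_eq_mul] at h
  have hB' : (B.card : ℝ) = S.card - G.card := by linarith
  rw [hB'] at hBsum
  nlinarith [hsum, hsplit, hGsum, hBsum]

/-- **Flatness of high-entropy images (the counting core of Liu–Pass's Claim 2)**, in linear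
form. Let `S` be a nonempty finite set, `f` a map on it, and suppose every surprise
`log₂ (|S| / |f⁻¹(f v) ∩ S|)` is at most `n` while their average — the Shannon entropy
`H(f(U_S))` — is at least `n - a` (`a ≥ 0`). Then for every property `Q` of outputs, the
probability that `f(U_S)` satisfies `Q` is at most `a/(a+1)` (the mass of "bad" points, whose
output has surprise `< n - a - 1`, by the reverse Markov inequality) plus `2^{a+1-n}` times the
*number* of outputs satisfying `Q` (each "good" output has probability `≤ 2^{-(n-a-1)}`):
`Pr_{v ← S}[Q(f v)] ≤ a/(a+1) + 2^{a+1-n} · #{y ∈ f(S) | Q y}`. Liu–Pass apply this with `S` the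
conditioning event, `f` the generator, `Q` = "the deterministic distinguisher `A_r` accepts",
`a = α log n`. [Y. Liu, R. Pass, FOCS 2020, proof of Thm 5.2, Claim 2; arXiv:2009.11514, §5.2]
[cite: LiuPassFOCS2020, Thm 5.2 (proof, Claim 2)] -/
theorem card_filter_div_card_le_of_mapEntropy {S : Finset ι} (hS : S.Nonempty) (f : ι → β)
    {n a : ℝ} (ha : 0 ≤ a)
    (hX : ∀ v ∈ S, Real.logb 2 ((S.card : ℝ) / (fiber S f (f v)).card) ≤ n)
    (hH : n - a ≤ mapEntropy S f) (Q : β → Prop) [DecidablePred Q] :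
    ((S.filter fun v => Q (f v)).card : ℝ) / S.card ≤
      a / (a + 1) + (2 : ℝ) ^ (a + 1 - n) * ((S.image f).filter Q).card := by
  classical
  have hSpos : (0 : ℝ) < S.card := by exact_mod_cast hS.card_pos
  set X : ι → ℝ := fun v => Real.logb 2 ((S.card : ℝ) / (fiber S f (f v)).card) with hXdef
  have hsum : (n - a) * S.card ≤ ∑ v ∈ S, X v := by
    have h := hH
    unfold mapEntropy at h
    rwa [le_div_iff₀ hSpos] at h
  have hMarkov := card_le_mul_card_filter_of_le_sum (S := S) (X := X) (N := n) (a := a) hX hsum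
  set good : ι → Prop := fun v => n - a - 1 ≤ X v with hgood
  -- fibres through good points are small
  have hpow : (0 : ℝ) < (2 : ℝ) ^ (a + 1 - n) := Real.rpow_pos_of_pos (by norm_num) _
  have hfib : ∀ v ∈ S, good v → ((fiber S f (f v)).card : ℝ) ≤ S.card * 2 ^ (a + 1 - n) := by
    intro v hv hg
    have hFpos : (0 : ℝ) < (fiber S f (f v)).card := by exact_mod_cast card_fiber_pos f hv
    have h1 : (2 : ℝ) ^ (n - a - 1) ≤ S.card / (fiber S f (f v)).card :=
      (Real.le_logb_iff_rpow_le (by norm_num) (div_pos hSpos hFpos)).1 hg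
    rw [le_div_iff₀ hFpos] at h1
    have h2 : (2 : ℝ) ^ (a + 1 - n) * 2 ^ (n - a - 1) = 1 := by
      rw [← Real.rpow_add (by norm_num), show a + 1 - n + (n - a - 1) = 0 by ring, Real.rpow_zero]
    calc ((fiber S f (f v)).card : ℝ)
        = 2 ^ (a + 1 - n) * (2 ^ (n - a - 1) * (fiber S f (f v)).card) := by
          rw [← mul_assoc, h2, one_mul]
      _ ≤ 2 ^ (a + 1 - n) * S.card := mul_le_mul_of_nonneg_left h1 hpow.le
      _ = S.card * 2 ^ (a + 1 - n) := mul_comm _ _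
  set T := S.filter fun v => Q (f v) with hT
  have hsplit : (T.card : ℝ) = (T.filter good).card + (T.filter fun v => ¬ good v).card := by
    exact_mod_cast (Finset.card_filter_add_card_filter_not (s := T) good).symm
  -- the bad part
  have hbad : ((T.filter fun v => ¬ good v).card : ℝ) ≤ S.card - (S.filter good).card := by
    have h1 : (T.filter fun v => ¬ good v) ⊆ S.filter fun v => ¬ good v :=
      Finset.filter_subset_filter _ (Finset.filter_subset _ _)
    have h2 : ((S.filter good).card : ℝ) + (S.filter fun v => ¬ good v).card = S.card := by
      exact_mod_cast Finset.card_filter_add_card_filter_not (s := S) good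
    have h3 : ((T.filter fun v => ¬ good v).card : ℝ) ≤ (S.filter fun v => ¬ good v).card := by
      exact_mod_cast Finset.card_le_card h1
    linarith
  -- the good part, fibrewise
  have hgoodpart : ((T.filter good).card : ℝ) ≤
      ((S.image f).filter Q).card * (S.card * 2 ^ (a + 1 - n)) := by
    have hdec := Finset.card_eq_sum_card_image f (T.filter good)
    have hsub : (T.filter good).image f ⊆ (S.image f).filter Q := by
      intro y hy
      simp only [Finset.mem_image, Finset.mem_filter, hT] at hy ⊢
      obtain ⟨v, ⟨⟨hvS, hQ⟩, _⟩, rfl⟩ := hy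
      exact ⟨⟨v, hvS, rfl⟩, hQ⟩
    have hterm : ∀ y ∈ (T.filter good).image f,
        (((T.filter good).filter fun v => f v = y).card : ℝ) ≤ S.card * 2 ^ (a + 1 - n) := by
      intro y hy
      simp only [Finset.mem_image, Finset.mem_filter, hT] at hy
      obtain ⟨v₀, ⟨⟨hv₀S, _⟩, hg₀⟩, rfl⟩ := hy
      calc (((T.filter good).filter fun v => f v = f v₀).card : ℝ) ≤ (fiber S f (f v₀)).card := by
            exact_mod_cast Finset.card_le_card fun v hv => by
              simp only [Finset.mem_filter, hT, mem_fiber] at hv ⊢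
              exact ⟨hv.1.1.1, hv.2⟩
        _ ≤ S.card * 2 ^ (a + 1 - n) := hfib v₀ hv₀S hg₀
    have hcnt : (((T.filter good).image f).card : ℝ) ≤ ((S.image f).filter Q).card := by
      exact_mod_cast Finset.card_le_card hsub
    calc ((T.filter good).card : ℝ)
        = ∑ y ∈ (T.filter good).image f, (((T.filter good).filter fun v => f v = y).card : ℝ) := by
          exact_mod_cast hdec
      _ ≤ ∑ _y ∈ (T.filter good).image f, ((S.card : ℝ) * (2 : ℝ) ^ (a + 1 - n)) :=
          Finset.sum_le_sum hterm
      _ = ((T.filter good).image f).card * (S.card * 2 ^ (a + 1 - n)) := by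
          rw [Finset.sum_const, nsmul_eq_mul]
      _ ≤ ((S.image f).filter Q).card * (S.card * 2 ^ (a + 1 - n)) :=
          mul_le_mul_of_nonneg_right hcnt (by positivity)
  -- assemble
  have hgoodfrac : (S.card : ℝ) / (a + 1) ≤ (S.filter good).card := by
    rw [div_le_iff₀ (by linarith)]
    linarith [hMarkov]
  rw [div_le_iff₀ hSpos]
  have ha1 : (a + 1) ≠ 0 := by linarith
  calc (T.card : ℝ) = (T.filter good).card + (T.filter fun v => ¬ good v).card := hsplit
    _ ≤ ((S.image f).filter Q).card * (S.card * 2 ^ (a + 1 - n)) + (S.card - (S.filter good).card) :=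
        add_le_add hgoodpart hbad
    _ ≤ ((S.image f).filter Q).card * (S.card * 2 ^ (a + 1 - n)) + (S.card - S.card / (a + 1)) := by
        linarith
    _ = (a / (a + 1) + 2 ^ (a + 1 - n) * ((S.image f).filter Q).card) * S.card := by
        field_simp
        ring

end Literature.InformationTheory.Entropy
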